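import Literature.NumberTheory.Automorphic.QuaternionAlgebraExistenceInert
import Literature.NumberTheory.QuadraticForms.HilbertReciprocityInputsProofs
import HarnessLib

/-!
# Vignéras III Thm. 3.1 holds: parity of ramification and existence with prescribed ramification
# (discharge of `even_card_ramified` and `exists_isQuaternionAlgebra_of_even`), and Hilbert reciprocity

Topic `NumberTheory/Automorphic`. M.-F. Vignéras, *Arithmétique des algèbres de quaternions*,
LNM 800 (1980), Ch. III §3, Théorème 3.1: a quaternion algebra over a number field `K` is ramified
at a finite, EVEN number of places, and for every finite set `S` of finite places and set `T` of
real places with `|S| + |T|` even there is a quaternion algebra over `K` ramified exactly at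
`S ∪ T` — both from the reciprocity law for the Hilbert symbol (O'Meara 71:18) and O'Meara 71:19.

Everything needed is already PROVED in the tree:

* `even_card_ramified_of_inert`, `exists_isQuaternionAlgebra_of_even_of_inert` and
  `QuadraticForms.hilbertReciprocity_of_inert` (`QuaternionAlgebraExistenceInert.lean`): the two
  named facts of `QuaternionAlgebraAdelic.lean` and Hilbert reciprocity from O'Meara 71:17 ALONE
  (the second inequality 65:21, `normIdeles_index_dvd_two_holds`, and Hasse's norm theorem 65:23,
  `hilbertSymbol_eq_one_of_forall_completions_holds`, being theorems of the tree);
* `QuadraticForms.range_localUnits_not_le_of_inertiaDegIn_eq_two_holds`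
  (`HilbertReciprocityInputsProofs.lean`): O'Meara 71:17 itself, proved along §65.

This file only composes them. No definition and no named fact is introduced.

## References

* M.-F. Vignéras, *Arithmétique des algèbres de quaternions*, LNM 800, Springer (1980), Ch. III
  §3 Thm. 3.1. [VignerasLNM800]
* O. T. O'Meara, *Introduction to quadratic forms*, Grundlehren 117, Springer (1963), §71C
  Prop. 71:17, §71D Thm. 71:18, 71:19. [Omeara1963]
-/

noncomputable section

universe u

namespace Literature.NumberTheory.QuadraticForms

/-- **Hilbert's reciprocity law holds** (O'Meara Thm. 71:18): `∏_𝔭 (a, b)_𝔭 = 1` for all `a, b`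
in a number field `K` — `hilbertReciprocity_of_inert` fed the tree's proof of O'Meara 71:17
(`range_localUnits_not_le_of_inertiaDegIn_eq_two_holds`). [cite: Omeara1963, §71D Thm. 71:18] -/
theorem hilbertReciprocity_holds (K : Type) [Field K] [NumberField K] (a b : K) :
    hilbertReciprocity K a b :=
  hilbertReciprocity_of_inert K (range_localUnits_not_le_of_inertiaDegIn_eq_two_holds K) a b

end Literature.NumberTheory.QuadraticForms

namespace Literature.NumberTheory.Automorphic

/-- **Vignéras III Thm. 3.1, parity half, holds**: a quaternion algebra `D` over a number field
`K` is ramified at an even number of places (finite and infinite) — the named fact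
`even_card_ramified K D` of `QuaternionAlgebraAdelic.lean`, by `even_card_ramified_of_inert` and
the tree's proof of O'Meara 71:17. [cite: VignerasLNM800, Ch. III §3 Thm. 3.1] -/
theorem even_card_ramified_holds (K : Type) [Field K] [NumberField K] (D : Type u) [Ring D]
    [Algebra K D] : even_card_ramified K D :=
  even_card_ramified_of_inert K D
    (QuadraticForms.range_localUnits_not_le_of_inertiaDegIn_eq_two_holds K)

/-- **Vignéras III Thm. 3.1, existence half, holds**: for every finite set `S` of finite places
and every finite set `T` of real places of a number field `K` with `|S| + |T|` even there is a
quaternion algebra over `K` ramified exactly at `S` and `T` — the named fact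
`exists_isQuaternionAlgebra_of_even K` of `QuaternionAlgebraAdelic.lean`, by
`exists_isQuaternionAlgebra_of_even_of_inert` and the tree's proof of O'Meara 71:17.
[cite: VignerasLNM800, Ch. III §3 Thm. 3.1] [cite: Omeara1963, §71D 71:19] -/
theorem exists_isQuaternionAlgebra_of_even_holds (K : Type) [Field K] [NumberField K] :
    exists_isQuaternionAlgebra_of_even K :=
  exists_isQuaternionAlgebra_of_even_of_inert K
    (QuadraticForms.range_localUnits_not_le_of_inertiaDegIn_eq_two_holds K)

end Literature.NumberTheory.Automorphic

end
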